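import Summits.PneNP.PneNP.Theorems.PhaseTwinsPolyDepthTwinsAboveDefs

/-!
# `PolyDepthTwinsAbove` (stmt-PneNP-2719), negative side III: `stub_tseitinGap` has no slack

Support file of the crux disprover (cdisprove seat, gen 2) for the line `parity-wired-ports` of the crux
`PhaseTwins.PolyDepthTwinsAbove`, companion of `Negative/TseitinGapCoupling.lean` (p75388).  The registered
stub `stub_tseitinGap` claims `∃ Y₀ ∀ Y, pwW (1_{w₀}) Y · e^{κ₂ g} ≤ pwW 0 Y₀` with `g = Ψ(0) − Ψ(1)`, and its
intended witness is the off-diagonal REFERENCE vector `Y₀ = (a = 0)` (copy `g_{·,0}` in phase `+`).  Here: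

* `tseitinGap_attained_at_reference` — under the odd charge the SAME reference vector already attains the
  bound: `pwW (1_{w₀}) Yref · e^{κ₂ g} = pwW 0 Yref` EXACTLY (every complex reads the reference port pattern,
  the one at `w₀` with charge `1`; `e^{κ₂(Ψ0−Ψ1)}` is precisely the quotient).  So the stub, once proved with
  its intended witness, is an equality at `Y = Yref`: the brute force of the work file (`Disproof.lean` §4d:
  `|log ratio| ≤ 5·10⁻¹³` in 24/24 instances) is this identity seen numerically.
* `tseitinGap_constant_optimal` — consequently the boost `e^{κ₂ g}` cannot be improved: for every `T > e^{κ₂ g}`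
  the strengthened stub is FALSE as soon as the reference vector maximises `pwW 0` (which is what any proof of
  the stub along the skeleton's lines establishes; stated as the hypothesis `hmax`).
Definition-free; no Theses statement is asserted. [folklore]
-/

noncomputable section

open scoped Classical BigOperators

set_option linter.dupNamespace false

namespace Summit.PneNP.PneNP.Theorems.PolyDepthTwinsAbove.Negative

open Summit.PneNP.PneNP.Cruxes.PolyDepthTwinsAbove.ParityWiredPorts
open Literature.Computability.Complexity.Expander (RotGraph)
open Literature.ModelTheory.FiniteModelTheory.TseitinColouring (Dart)

/-- **The reference vector attains `stub_tseitinGap`'s bound under the odd charge.**  With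
`Yref (δ, a) := (a = 0)`, every complex reads the reference port pattern `p ↦ (p.2 = 0)` whatever the base `R`,
so `pwW c Yref = (pair product) · Π_w cxW (c w) ref ^ κ₂`; for `c = 1_{w₀}` versus `c = 0` the quotient is
`(cxW 1 ref / cxW 0 ref)^{κ₂} = e^{−κ₂ (Ψ0 − Ψ1)}`. -/
theorem tseitinGap_attained_at_reference {M : ℕ} (R : RotGraph M 3) (w₀ : Fin M) {lam qp qm : ℝ}
    (hlam : 0 ≤ lam) (hqm1 : qm ≤ 1) (hqp1 : qp ≤ 1) (κ₁ κ₂ : ℕ) :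
    pwW R lam qp qm κ₁ κ₂ (Pi.single w₀ 1) (fun g => decide (g.2 = 0)) *
        Real.exp (κ₂ * (pwPsi lam qp qm 0 - pwPsi lam qp qm 1)) =
      pwW R lam qp qm κ₁ κ₂ 0 (fun g => decide (g.2 = 0)) := by
  -- positivity of the two reference complex factors
  have hpos : ∀ e : ZMod 2, 0 < cxW lam qp qm e (fun p => decide (p.2 = 0)) := by
    intro e
    unfold cxW cxWeight
    refine div_pos ?_ (pow_pos (by linarith) _)
    have hx : ∀ p : Fin 3 × ZMod 2, 0 ≤ 1 - occP qp qm (decide (p.2 = 0)) := by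
      intro p; unfold occP; split_ifs <;> linarith
    have hterm : ∀ J : Finset CxVert, 0 ≤ (if (cxGraph e).IsIndepSet (↑J : Set CxVert) then
        lam ^ J.card * ∏ p : Fin 3 × ZMod 2,
          (if (Sum.inl p : CxVert) ∈ J then 1 - occP qp qm (decide (p.2 = 0)) else 1) else 0) := by
      intro J
      split_ifs
      · exact mul_nonneg (pow_nonneg hlam _)
          (Finset.prod_nonneg fun p _ => by split_ifs <;> [exact hx p; exact zero_le_one])
      · exact le_rfl
    have hempty : (if (cxGraph e).IsIndepSet (↑(∅ : Finset CxVert) : Set CxVert) then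
        lam ^ (∅ : Finset CxVert).card * ∏ p : Fin 3 × ZMod 2,
          (if (Sum.inl p : CxVert) ∈ (∅ : Finset CxVert) then 1 - occP qp qm (decide (p.2 = 0)) else 1)
        else 0) = 1 := by
      have h : (cxGraph e).IsIndepSet ((∅ : Finset CxVert) : Set CxVert) := by
        simp [SimpleGraph.IsIndepSet, Set.Pairwise]
      rw [if_pos h]
      simp
    calc (0 : ℝ) < 1 := one_pos
      _ = _ := hempty.symm
      _ ≤ _ := Finset.single_le_sum (fun J _ => hterm J) (Finset.mem_univ (∅ : Finset CxVert))
  set A : ℝ := cxW lam qp qm 0 (fun p => decide (p.2 = 0)) with hA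
  set B : ℝ := cxW lam qp qm 1 (fun p => decide (p.2 = 0)) with hB
  have hA0 : 0 < A := hpos 0
  have hB0 : 0 < B := hpos 1
  -- the boost is `(A / B) ^ κ₂`
  have hexp : Real.exp (κ₂ * (pwPsi lam qp qm 0 - pwPsi lam qp qm 1)) = (A / B) ^ κ₂ := by
    unfold pwPsi
    rw [← hA, ← hB, ← Real.log_div hA0.ne' hB0.ne', ← Real.log_pow, Real.exp_log (pow_pos (div_pos hA0 hB0) _)]
  -- the complex products under the two charges
  have hprod1 : (∏ w : Fin M, cxW lam qp qm ((Pi.single w₀ (1 : ZMod 2) : Fin M → ZMod 2) w)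
      (fun p => decide ((((canonEnd R (w, p.1)).1, p.2) : Dart M 3 × ZMod 2).2 = 0)) ^ κ₂) =
      B ^ κ₂ * ∏ w ∈ (Finset.univ : Finset (Fin M)).erase w₀, A ^ κ₂ := by
    rw [← Finset.mul_prod_erase Finset.univ _ (Finset.mem_univ w₀)]
    congr 1
    · simp [hB]
    · refine Finset.prod_congr rfl fun w hw => ?_
      have hne : w ≠ w₀ := Finset.ne_of_mem_erase hw
      simp [hA, hne]
  have hprod0 : (∏ w : Fin M, cxW lam qp qm ((0 : Fin M → ZMod 2) w)
      (fun p => decide ((((canonEnd R (w, p.1)).1, p.2) : Dart M 3 × ZMod 2).2 = 0)) ^ κ₂) =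
      A ^ κ₂ * ∏ w ∈ (Finset.univ : Finset (Fin M)).erase w₀, A ^ κ₂ := by
    rw [← Finset.mul_prod_erase Finset.univ _ (Finset.mem_univ w₀)]
    congr 1
  have key : B ^ κ₂ * (A / B) ^ κ₂ = A ^ κ₂ := by
    rw [← mul_pow, mul_div_assoc', mul_div_cancel_left₀ A hB0.ne']
  unfold pwW
  rw [hprod1, hprod0, hexp]
  calc _ = (∏ δ : Dart M 3, if Literature.ModelTheory.FiniteModelTheory.CFIMatching.Canon R δ then
        pairW qp qm κ₁ (decide (((δ, (0 : ZMod 2)) : Dart M 3 × ZMod 2).2 = 0))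
          (decide (((δ, (1 : ZMod 2)) : Dart M 3 × ZMod 2).2 = 0)) else 1) *
      ((B ^ κ₂ * (A / B) ^ κ₂) * ∏ w ∈ (Finset.univ : Finset (Fin M)).erase w₀, A ^ κ₂) := by ring
    _ = _ := by rw [key]

/-- **The boost `e^{κ₂ g}` of `stub_tseitinGap` is optimal.**  If the reference vector maximises the
charge-`0` weight (the content of any proof of the stub along the skeleton's lines), then for every
`T > e^{κ₂ g}` the strengthened conclusion `∃ Y₀ ∀ Y, pwW (1_{w₀}) Y · T ≤ pwW 0 Y₀` FAILS: test it at
`Y = Yref`, where the unstrengthened bound is already an equality (`tseitinGap_attained_at_reference`). -/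
theorem tseitinGap_constant_optimal {M : ℕ} (R : RotGraph M 3) (w₀ : Fin M) {lam qp qm : ℝ}
    (hlam : 0 ≤ lam) (hqm0 : 0 ≤ qm) (hqm1 : qm < 1) (hqp0 : 0 ≤ qp) (hqp1 : qp < 1) (κ₁ κ₂ : ℕ)
    (hmax : ∀ Y : Dart M 3 × ZMod 2 → Bool,
      pwW R lam qp qm κ₁ κ₂ 0 Y ≤ pwW R lam qp qm κ₁ κ₂ 0 (fun g => decide (g.2 = 0)))
    {T : ℝ} (hT : Real.exp (κ₂ * (pwPsi lam qp qm 0 - pwPsi lam qp qm 1)) < T) :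
    ¬ ∃ Y₀ : Dart M 3 × ZMod 2 → Bool, ∀ Y : Dart M 3 × ZMod 2 → Bool,
      pwW R lam qp qm κ₁ κ₂ (Pi.single w₀ 1) Y * T ≤ pwW R lam qp qm κ₁ κ₂ 0 Y₀ := by
  rintro ⟨Y₀, h⟩
  have href := h (fun g => decide (g.2 = 0))
  have heq := tseitinGap_attained_at_reference R w₀ hlam hqm1.le hqp1.le κ₁ κ₂
  -- the odd-charge weight of the reference vector is positive
  have hW1 : 0 < pwW R lam qp qm κ₁ κ₂ (Pi.single w₀ 1) (fun g => decide (g.2 = 0)) := by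
    have hocc : ∀ s, 0 ≤ occP qp qm s ∧ occP qp qm s < 1 ∧ 0 ≤ occM qp qm s ∧ occM qp qm s < 1 := by
      intro s
      cases s
      · simp only [occP, occM, Bool.false_eq_true, if_false]
        exact ⟨hqm0, hqm1, hqp0, hqp1⟩
      · simp only [occP, occM, if_true]
        exact ⟨hqp0, hqp1, hqm0, hqm1⟩
    have hpair : ∀ s t, 0 < pairW qp qm κ₁ s t := by
      intro s t
      unfold pairW
      obtain ⟨h1, h2, h5, h6⟩ := hocc s
      obtain ⟨h3, h4, h7, h8⟩ := hocc t
      have hP : occP qp qm s * occP qp qm t < 1 := mul_lt_one_of_nonneg_of_lt_one_left h1 h2 h4.le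
      have hM : occM qp qm s * occM qp qm t < 1 := mul_lt_one_of_nonneg_of_lt_one_left h5 h6 h8.le
      exact pow_pos (mul_pos (by linarith) (by linarith)) _
    unfold pwW
    refine mul_pos (Finset.prod_pos fun δ _ => ?_) (Finset.prod_pos fun w _ => pow_pos ?_ _)
    · split_ifs
      · exact hpair _ _
      · exact one_pos
    · -- positivity of a complex factor: the empty configuration contributes `1`
      unfold cxW cxWeight
      refine div_pos ?_ (pow_pos (by linarith) _)
      have hx : ∀ p : Fin 3 × ZMod 2, 0 ≤ 1 - occP qp qm
          (decide ((((canonEnd R (w, p.1)).1, p.2) : Dart M 3 × ZMod 2).2 = 0)) := by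
        intro p; unfold occP; split_ifs <;> linarith
      refine lt_of_lt_of_le one_pos ?_
      refine le_trans ?_ (Finset.single_le_sum (f := fun J : Finset CxVert =>
        if (cxGraph ((Pi.single w₀ (1 : ZMod 2) : Fin M → ZMod 2) w)).IsIndepSet (↑J : Set CxVert) then
          lam ^ J.card * ∏ p : Fin 3 × ZMod 2, (if (Sum.inl p : CxVert) ∈ J then 1 - occP qp qm
            (decide ((((canonEnd R (w, p.1)).1, p.2) : Dart M 3 × ZMod 2).2 = 0)) else 1) else 0)
        (fun J _ => ?_) (Finset.mem_univ (∅ : Finset CxVert)))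
      · have h0 : (cxGraph ((Pi.single w₀ (1 : ZMod 2) : Fin M → ZMod 2) w)).IsIndepSet
            ((∅ : Finset CxVert) : Set CxVert) := by
          simp [SimpleGraph.IsIndepSet, Set.Pairwise]
        rw [if_pos h0]
        simp
      · dsimp only
        split_ifs
        · exact mul_nonneg (pow_nonneg hlam _)
            (Finset.prod_nonneg fun p _ => by split_ifs <;> [exact hx p; exact zero_le_one])
        · exact le_rfl
  have hlt : pwW R lam qp qm κ₁ κ₂ (Pi.single w₀ 1) (fun g => decide (g.2 = 0)) *
      Real.exp (κ₂ * (pwPsi lam qp qm 0 - pwPsi lam qp qm 1)) <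
      pwW R lam qp qm κ₁ κ₂ (Pi.single w₀ 1) (fun g => decide (g.2 = 0)) * T :=
    mul_lt_mul_of_pos_left hT hW1
  have := hmax Y₀
  linarith
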